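import Summits.QuantumFields.YangMills.Theorems.LuscherReductionTwistedTraceScalingGaugeAverage
import Summits.QuantumFields.YangMills.Theorems.LuscherReductionRunningReductionTraceFormulaAveraging
import Literature.MathematicalPhysics.QuantumFieldTheory.StrongCouplingActivities
import HarnessLib

/-!
# The GAUGE SLICE identity (Faddeev–Popov without a gauge condition): the transfer form of a gauge-INVARIANT test function equals the
# form of a NON-invariant «slice function» supported wherever one likes, against the gauge-AVERAGED transfer operator
# (lane A of S-BASE, crux `TwistedTraceScaling` stmt-QuantumFields-20203, sub-target C4 INNER; design note `pub/ym-fleet/ym-luscher-20007-p1/COARSE-DESIGN.md` §23)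

WHY.  The inner one-orbit min–max problem (`InnerNoIntruderOneOrbitAt`) quantifies over gauge-invariant test functions `ψ` supported in the
orbit neighbourhood `{orbitDist < δ}` — a set that is thin transversally to the gauge orbit of the vacuum but contains WHOLE gauge orbits
(`3(L³−1)` compact directions of diameter `O(1)`).  Every Born–Oppenheimer comparison of the kernel with `(one-site kernel) ⊗ (stiff Gaussian)`
lives in a thin tube around the slow manifold of CONSTANT configurations, where linear coordinates exist.  The architecture of record (§21 of the
design note) reached the tube through a product chart `(c, q, g) ↦ (E(q)·constLift c)^g` with the based gauge transformation `g` as a COORDINATE —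
which needs BCH bounds for finite `g` and a Jacobian with a gauge block.  THIS FILE removes the gauge coordinate: for ANY bounded measurable weight
`χ` (e.g. the indicator of a thin tube `T`) whose gauge average `N = gaugeAvg χ` (for an indicator: the Faddeev–Popov normalisation
`N(U) = Haar{g : U^g ∈ T}`) is bounded away from zero on the support of `χ`, and any gauge-invariant bounded measurable `ψ` vanishing where `N`
does, the SLICE FUNCTION `f = ψ·χ/N` (tree name `sliceFn χ ψ`, supported in `supp χ`) satisfies, EXACTLY:
* `gaugeAvg_sliceFn`      — `gaugeAvg f = ψ` (the gauge average reconstructs `ψ`);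
* `qform_eq_sliceFn`      — `⟨ψ, K_β φ⟩ = ⟨f_ψ, gaugeAvg (K_β f_φ)⟩_{L²}`: the transfer form of invariant functions is the form of their slice functions
  against the gauge-AVERAGED transfer operator `gaugeAvg ∘ K_β` (tree `transferApply_gaugeAvg`: the two commute; its kernel
  `K̃_β(U,V) = ∫ K_β(U, V^g) dg` and the kernel form of the identities are in the sequel `…GaugeSliceKernel`);
* `l2_eq_sliceFn_left`    — `⟨ψ, φ⟩ = ⟨f_ψ, φ⟩`, and for an idempotent weight (`χ² = χ`, indicators) `l2_eq_integral_sliceFn_mul_weight`: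
  `⟨ψ, φ⟩ = ∫ f_ψ f_φ · N`;
* `sliceFn` is linear in `ψ`, measurable, bounded by `C_ψ C_χ / n₀`, and supported in `supp χ ∩ supp ψ`.
So the invariant min–max problem on the fat region IS the min–max problem for the averaged kernel `K̃_β` on `L²(supp χ, N dU)` — no approximation,
no gauge condition, no Gribov question (every `χ` works; the weight `N` carries the Faddeev–Popov determinant).  The engine is one Fubini identity,
`integral_gaugeAvg_mul_invariant`: `∫ (gaugeAvg f)·F = ∫ f·F` for gauge-invariant `F` (invariance of the a-priori measure under gauge transformations).
HONEST FRAMING: exact symmetry bookkeeping (Fubini + invariance) for a stub of a child of the CONDITIONAL reduction route R2b1; no kernel estimate here;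
C4 remains OPEN; not infinite volume, not a gap, not Clay.
-/

set_option autoImplicit false

noncomputable section

open MeasureTheory Filter Topology Real
open scoped BigOperators
open Literature.MathematicalPhysics.QuantumFieldTheory
open Literature.MathematicalPhysics.QuantumLattice

namespace Summit.QuantumFields.YangMills.Theorems.FemtoTransferGap.TwoLattice.Avg

open Summit.QuantumFields.YangMills.Theorems.FemtoTransferGap

variable {L : ℕ} [NeZero L]

/-! ## §1 The Fubini engine: `∫ (gaugeAvg f)·F = ∫ f·F` for gauge-invariant `F` -/

/-- ★ **Averaging is self-adjoint against invariants**: for bounded measurable `f` and bounded measurable gauge-INVARIANT `F`,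
`∫ (gaugeAvg f)(U) F(U) dU = ∫ f(U) F(U) dU` (Fubini on `configMeasure ⊗ gaugeMeasure`, invariance of `configMeasure` under each gauge
transformation, invariance of `F`). [cite: SeilerLNP1982, §2] -/
theorem integral_gaugeAvg_mul_invariant {f F : GaugeConfig 3 L SU2 → ℝ} (hf : Measurable f) {Cf : ℝ} (hCf : ∀ U, |f U| ≤ Cf)
    (hF : Measurable F) {CF : ℝ} (hCF : ∀ U, |F U| ≤ CF) (hFinv : ∀ (g : Site 3 L → SU2) (U : GaugeConfig 3 L SU2), F (gaugeTransform g U) = F U) :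
    ∫ U, gaugeAvg f U * F U ∂configMeasure SU2 L = ∫ U, f U * F U ∂configMeasure SU2 L := by
  -- the jointly measurable bounded integrand `(U, g) ↦ f(U^g) F(U^g)`
  have hJ : Measurable fun p : GaugeConfig 3 L SU2 × (Site 3 L → SU2) => f (gaugeTransform p.2 p.1) * F (gaugeTransform p.2 p.1) :=
    (measurable_comp_gaugeAction hf).mul (measurable_comp_gaugeAction hF)
  have hJb : ∀ p : GaugeConfig 3 L SU2 × (Site 3 L → SU2), |f (gaugeTransform p.2 p.1) * F (gaugeTransform p.2 p.1)| ≤ Cf * CF := fun p => by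
    rw [abs_mul]; exact mul_le_mul (hCf _) (hCF _) (abs_nonneg _) ((abs_nonneg (f p.1)).trans (hCf p.1))
  have hint : Integrable (fun p : GaugeConfig 3 L SU2 × (Site 3 L → SU2) => f (gaugeTransform p.2 p.1) * F (gaugeTransform p.2 p.1))
      ((configMeasure SU2 L).prod (gaugeMeasure L)) :=
    integrable_of_measurable_abs_le _ hJ hJb
  calc ∫ U, gaugeAvg f U * F U ∂configMeasure SU2 L
      = ∫ U, ∫ g, f (gaugeTransform g U) * F (gaugeTransform g U) ∂gaugeMeasure L ∂configMeasure SU2 L := by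
        refine integral_congr_ae (ae_of_all _ fun U => ?_)
        dsimp only
        unfold gaugeAvg
        rw [← integral_mul_const]
        refine integral_congr_ae (ae_of_all _ fun g => ?_)
        dsimp only
        rw [hFinv]
    _ = ∫ g, ∫ U, f (gaugeTransform g U) * F (gaugeTransform g U) ∂configMeasure SU2 L ∂gaugeMeasure L := integral_integral_swap hint
    _ = ∫ g, ∫ U, f U * F U ∂configMeasure SU2 L ∂gaugeMeasure L := by
        refine integral_congr_ae (ae_of_all _ fun g => ?_)
        dsimp only
        exact integral_comp_eq_of_measurePreserving (measurePreserving_gaugeTransform_configMeasure g)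
          (F := fun W => f W * F W) (hf.mul hF)
    _ = ∫ U, f U * F U ∂configMeasure SU2 L := by simp [integral_const]

/-- The same with the factors commuted: `∫ F·(gaugeAvg f) = ∫ F·f`. [cite: SeilerLNP1982, §2] -/
theorem integral_invariant_mul_gaugeAvg {f F : GaugeConfig 3 L SU2 → ℝ} (hf : Measurable f) {Cf : ℝ} (hCf : ∀ U, |f U| ≤ Cf)
    (hF : Measurable F) {CF : ℝ} (hCF : ∀ U, |F U| ≤ CF) (hFinv : ∀ (g : Site 3 L → SU2) (U : GaugeConfig 3 L SU2), F (gaugeTransform g U) = F U) :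
    ∫ U, F U * gaugeAvg f U ∂configMeasure SU2 L = ∫ U, F U * f U ∂configMeasure SU2 L := by
  simp_rw [mul_comm (F _)]
  exact integral_gaugeAvg_mul_invariant hf hCf hF hCF hFinv

/-- The transfer operator maps gauge-invariant (measurable) functions to gauge-invariant functions. [cite: SeilerLNP1982, §3] -/
theorem transferApply_gaugeTransform_of_invariant (β : ℝ) {φ : GaugeConfig 3 L SU2 → ℝ} (hφ : Measurable φ)
    (hφinv : ∀ (g : Site 3 L → SU2) (U : GaugeConfig 3 L SU2), φ (gaugeTransform g U) = φ U) (g : Site 3 L → SU2) (U : GaugeConfig 3 L SU2) :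
    transferApply β φ (gaugeTransform g U) = transferApply β φ U := by
  rw [← transferApply_comp_gaugeTransform β hφ g U]
  simp_rw [hφinv]

/-- The gauge average of a gauge-invariant (measurable) function is the function itself. [folklore] -/
theorem gaugeAvg_of_invariant {φ : GaugeConfig 3 L SU2 → ℝ}
    (hφinv : ∀ (g : Site 3 L → SU2) (U : GaugeConfig 3 L SU2), φ (gaugeTransform g U) = φ U) (U : GaugeConfig 3 L SU2) :
    gaugeAvg φ U = φ U := by
  unfold gaugeAvg
  simp_rw [hφinv]
  simp [integral_const]

omit [NeZero L] in
/-- The gauge action `(U, g) ↦ U^g` is jointly measurable. [folklore] -/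
theorem measurable_gaugeAction : Measurable fun p : GaugeConfig 3 L SU2 × (Site 3 L → SU2) => gaugeTransform p.2 p.1 := by
  refine measurable_pi_lambda _ fun e => ?_
  simp only [gaugeTransform]
  exact ((((measurable_pi_apply e.1).comp measurable_snd).mul ((measurable_pi_apply e).comp measurable_fst)).mul
    ((measurable_pi_apply (e.1.shift e.2)).comp measurable_snd).inv)

omit [NeZero L] in
/-- `(U, g) ↦ U^{g⁻¹}` is jointly measurable. [folklore] -/
theorem measurable_gaugeAction_inv : Measurable fun p : GaugeConfig 3 L SU2 × (Site 3 L → SU2) => gaugeTransform p.2⁻¹ p.1 := by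
  refine measurable_pi_lambda _ fun e => ?_
  simp only [gaugeTransform, Pi.inv_apply, inv_inv]
  exact ((((measurable_pi_apply e.1).comp measurable_snd).inv.mul ((measurable_pi_apply e).comp measurable_fst)).mul
    ((measurable_pi_apply (e.1.shift e.2)).comp measurable_snd))

omit [NeZero L] in
/-- `(g, U) ↦ U^{g⁻¹}` is jointly measurable. [folklore] -/
theorem measurable_gaugeAction_inv' : Measurable fun p : (Site 3 L → SU2) × GaugeConfig 3 L SU2 => gaugeTransform p.1⁻¹ p.2 := by
  refine measurable_pi_lambda _ fun e => ?_
  simp only [gaugeTransform, Pi.inv_apply, inv_inv]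
  exact ((((measurable_pi_apply e.1).comp measurable_fst).inv.mul ((measurable_pi_apply e).comp measurable_snd)).mul
    ((measurable_pi_apply (e.1.shift e.2)).comp measurable_fst))

/-- Moving a gauge transformation from the second to the first argument of the kernel: `K_β(U, V^g) = K_β(V, U^{g⁻¹})`. [folklore] -/
theorem transferKernel_gaugeTransform_right_eq (β : ℝ) (g : Site 3 L → SU2) (U V : GaugeConfig 3 L SU2) :
    transferKernel su2Rep β U (gaugeTransform g V) = transferKernel su2Rep β V (gaugeTransform g⁻¹ U) := by
  rw [← transferKernel_gaugeTransform su2Rep β g⁻¹ U (gaugeTransform g V), TT.gaugeTransform_inv_gaugeTransform, transferKernel_su2Rep_symm]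

/-! ## §3 The slice function `f = ψ·χ/N` -/

/-- **The slice function** of `ψ` with respect to the weight `χ`: `sliceFn χ ψ = ψ · χ / gaugeAvg χ` (Lean's `x / 0 = 0` makes it vanish where the
normalisation `N = gaugeAvg χ` vanishes). For `χ = 1_T` the indicator of a tube, `N(U)` is the Haar measure of `{g : U^g ∈ T}` — the
Faddeev–Popov normalisation — and `sliceFn χ ψ` is `ψ/N` restricted to `T`. [cite: SeilerLNP1982, §2] -/
def sliceFn (χ ψ : GaugeConfig 3 L SU2 → ℝ) : GaugeConfig 3 L SU2 → ℝ :=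
  fun U => ψ U * χ U / gaugeAvg χ U

/-- The slice function is linear in `ψ`: finite linear combinations. [folklore] -/
theorem sliceFn_sum {k : ℕ} (χ : GaugeConfig 3 L SU2 → ℝ) (a : Fin k → ℝ) (G : Fin k → GaugeConfig 3 L SU2 → ℝ) :
    sliceFn χ (fun U => ∑ i, a i * G i U) = fun U => ∑ i, a i * sliceFn χ (G i) U := by
  funext U
  simp only [sliceFn, Finset.sum_mul, Finset.sum_div, mul_assoc, mul_div_assoc]

/-- `sliceFn χ (c·ψ) = c · sliceFn χ ψ`. [folklore] -/
theorem sliceFn_const_mul (χ ψ : GaugeConfig 3 L SU2 → ℝ) (c : ℝ) :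
    sliceFn χ (fun U => c * ψ U) = fun U => c * sliceFn χ ψ U := by
  funext U; simp only [sliceFn]; ring

/-- `sliceFn χ (ψ + φ) = sliceFn χ ψ + sliceFn χ φ`. [folklore] -/
theorem sliceFn_add (χ ψ φ : GaugeConfig 3 L SU2 → ℝ) :
    sliceFn χ (fun U => ψ U + φ U) = fun U => sliceFn χ ψ U + sliceFn χ φ U := by
  funext U; simp only [sliceFn]; ring

/-- The slice function is supported in `supp χ ∩ supp ψ`. [folklore] -/
theorem sliceFn_ne_zero {χ ψ : GaugeConfig 3 L SU2 → ℝ} {U : GaugeConfig 3 L SU2} (h : sliceFn χ ψ U ≠ 0) : χ U ≠ 0 ∧ ψ U ≠ 0 := by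
  have h' : ψ U * χ U / gaugeAvg χ U ≠ 0 := h
  have h1 : ψ U * χ U ≠ 0 := (div_ne_zero_iff.mp h').1
  exact ⟨(mul_ne_zero_iff.mp h1).2, (mul_ne_zero_iff.mp h1).1⟩

/-- The slice function is measurable. [folklore] -/
theorem measurable_sliceFn {χ ψ : GaugeConfig 3 L SU2 → ℝ} (hχ : Measurable χ) (hψ : Measurable ψ) : Measurable (sliceFn χ ψ) :=
  (hψ.mul hχ).div (measurable_gaugeAvg hχ)

/-- The slice function is bounded: `|f| ≤ C_ψ C_χ / n₀` if `N ≥ n₀ > 0` on the support of `χ`. [folklore] -/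
theorem abs_sliceFn_le {χ ψ : GaugeConfig 3 L SU2 → ℝ} {Cχ Cψ n₀ : ℝ} (hCχ : ∀ U, |χ U| ≤ Cχ) (hCψ : ∀ U, |ψ U| ≤ Cψ) (hn₀ : 0 < n₀)
    (hN : ∀ U, χ U ≠ 0 → n₀ ≤ gaugeAvg χ U) (U : GaugeConfig 3 L SU2) : |sliceFn χ ψ U| ≤ Cψ * Cχ / n₀ := by
  have hCψ0 : 0 ≤ Cψ := (abs_nonneg _).trans (hCψ U)
  have hCχ0 : 0 ≤ Cχ := (abs_nonneg _).trans (hCχ U)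
  unfold sliceFn
  by_cases h0 : χ U = 0
  · rw [h0, mul_zero, zero_div, abs_zero]; positivity
  · have hNU := hN U h0
    have hNpos : 0 < gaugeAvg χ U := hn₀.trans_le hNU
    rw [abs_div, abs_mul, abs_of_pos hNpos, div_le_div_iff₀ hNpos hn₀]
    calc |ψ U| * |χ U| * n₀ ≤ Cψ * Cχ * n₀ := by gcongr <;> simp [hCψ, hCχ]
      _ ≤ Cψ * Cχ * gaugeAvg χ U := by gcongr

/-- ★ **The gauge average reconstructs `ψ`**: `gaugeAvg (sliceFn χ ψ) = ψ` for gauge-invariant `ψ` vanishing wherever `N = gaugeAvg χ` does.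
[cite: SeilerLNP1982, §2] -/
theorem gaugeAvg_sliceFn {χ ψ : GaugeConfig 3 L SU2 → ℝ}
    (hψinv : ∀ (g : Site 3 L → SU2) (U : GaugeConfig 3 L SU2), ψ (gaugeTransform g U) = ψ U)
    (hcov : ∀ U, ψ U ≠ 0 → gaugeAvg χ U ≠ 0) (U : GaugeConfig 3 L SU2) : gaugeAvg (sliceFn χ ψ) U = ψ U := by
  have h1 : ∀ g : Site 3 L → SU2, sliceFn χ ψ (gaugeTransform g U) = ψ U / gaugeAvg χ U * χ (gaugeTransform g U) := fun g => by
    simp only [sliceFn, hψinv, gaugeAvg_gaugeTransform]; ring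
  calc gaugeAvg (sliceFn χ ψ) U = ∫ g, sliceFn χ ψ (gaugeTransform g U) ∂gaugeMeasure L := rfl
    _ = ∫ g, ψ U / gaugeAvg χ U * χ (gaugeTransform g U) ∂gaugeMeasure L := by simp_rw [h1]
    _ = ψ U / gaugeAvg χ U * gaugeAvg χ U := by rw [integral_const_mul]; rfl
    _ = ψ U := by
        by_cases hN : gaugeAvg χ U = 0
        · have hψ0 : ψ U = 0 := by by_contra h'; exact hcov U h' hN
          simp [hψ0]
        · exact div_mul_cancel₀ _ hN

/-! ## §4 The identities: transfer form and `L²` pairing through the slice -/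

/-- ★★ **THE GAUGE SLICE IDENTITY for the transfer form**: for gauge-invariant bounded measurable `ψ, φ` (vanishing where `N` does) and a
bounded measurable weight `χ` with `N = gaugeAvg χ ≥ n₀ > 0` on `supp χ`:
`⟨ψ, K_β φ⟩ = ⟨sliceFn χ ψ, gaugeAvg (K_β (sliceFn χ φ))⟩_{L²}`. [cite: SeilerLNP1982, §3] -/
theorem qform_eq_sliceFn (β : ℝ) {χ ψ φ : GaugeConfig 3 L SU2 → ℝ} (hχ : Measurable χ) {Cχ : ℝ} (hCχ : ∀ U, |χ U| ≤ Cχ) {n₀ : ℝ} (hn₀ : 0 < n₀)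
    (hN : ∀ U, χ U ≠ 0 → n₀ ≤ gaugeAvg χ U)
    (hψ : Measurable ψ) {Cψ : ℝ} (hCψ : ∀ U, |ψ U| ≤ Cψ) (hψinv : ∀ (g : Site 3 L → SU2) (U : GaugeConfig 3 L SU2), ψ (gaugeTransform g U) = ψ U)
    (hψcov : ∀ U, ψ U ≠ 0 → gaugeAvg χ U ≠ 0)
    (hφ : Measurable φ) {Cφ : ℝ} (hCφ : ∀ U, |φ U| ≤ Cφ) (hφinv : ∀ (g : Site 3 L → SU2) (U : GaugeConfig 3 L SU2), φ (gaugeTransform g U) = φ U)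
    (hφcov : ∀ U, φ U ≠ 0 → gaugeAvg χ U ≠ 0) :
    qform su2Rep β ψ φ = l2 (sliceFn χ ψ) (gaugeAvg (transferApply β (sliceFn χ φ))) := by
  haveI : SecondCountableTopology SU2 := secondCountableTopology_su2
  obtain ⟨M, hM⟩ := exists_transferKernel_le su2Rep continuous_su2Rep β (L := L)
  have hfψ := measurable_sliceFn hχ hψ
  have hfφ := measurable_sliceFn hχ hφ
  have hfψb := abs_sliceFn_le hCχ hCψ hn₀ hN
  have hfφb := abs_sliceFn_le hCχ hCφ hn₀ hN
  -- `K φ` is invariant, bounded, measurable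
  have hKφ : Measurable (transferApply β φ) := measurable_transferApply β hφ
  have hKφb : ∀ U, |transferApply β φ U| ≤ M * Cφ := abs_transferApply_le β hM hφ hCφ
  have hKφinv := transferApply_gaugeTransform_of_invariant β hφ hφinv
  calc qform su2Rep β ψ φ = l2 ψ (transferApply β φ) := qform_eq_l2_transferApply β ψ φ
    _ = ∫ U, gaugeAvg (sliceFn χ ψ) U * transferApply β φ U ∂configMeasure SU2 L := by
        unfold l2
        refine integral_congr_ae (ae_of_all _ fun U => ?_)
        dsimp only
        rw [gaugeAvg_sliceFn hψinv hψcov]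
    _ = ∫ U, sliceFn χ ψ U * transferApply β φ U ∂configMeasure SU2 L :=
        integral_gaugeAvg_mul_invariant hfψ hfψb hKφ hKφb hKφinv
    _ = ∫ U, sliceFn χ ψ U * transferApply β (gaugeAvg (sliceFn χ φ)) U ∂configMeasure SU2 L := by
        refine integral_congr_ae (ae_of_all _ fun U => ?_)
        dsimp only
        congr 1
        rw [transferApply_apply, transferApply_apply]
        refine integral_congr_ae (ae_of_all _ fun V => ?_)
        dsimp only
        rw [gaugeAvg_sliceFn hφinv hφcov]
    _ = l2 (sliceFn χ ψ) (gaugeAvg (transferApply β (sliceFn χ φ))) := by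
        unfold l2
        refine integral_congr_ae (ae_of_all _ fun U => ?_)
        dsimp only
        rw [transferApply_gaugeAvg β hfφ hfφb]

/-- ★ **`L²` pairing through the slice (one side)**: `⟨ψ, φ⟩ = ⟨sliceFn χ ψ, φ⟩` for invariant `ψ, φ`. [cite: SeilerLNP1982, §2] -/
theorem l2_eq_sliceFn_left {χ ψ φ : GaugeConfig 3 L SU2 → ℝ} (hχ : Measurable χ) {Cχ : ℝ} (hCχ : ∀ U, |χ U| ≤ Cχ) {n₀ : ℝ} (hn₀ : 0 < n₀)
    (hN : ∀ U, χ U ≠ 0 → n₀ ≤ gaugeAvg χ U)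
    (hψ : Measurable ψ) {Cψ : ℝ} (hCψ : ∀ U, |ψ U| ≤ Cψ) (hψinv : ∀ (g : Site 3 L → SU2) (U : GaugeConfig 3 L SU2), ψ (gaugeTransform g U) = ψ U)
    (hψcov : ∀ U, ψ U ≠ 0 → gaugeAvg χ U ≠ 0)
    (hφ : Measurable φ) {Cφ : ℝ} (hCφ : ∀ U, |φ U| ≤ Cφ) (hφinv : ∀ (g : Site 3 L → SU2) (U : GaugeConfig 3 L SU2), φ (gaugeTransform g U) = φ U) :
    l2 ψ φ = l2 (sliceFn χ ψ) φ := by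
  unfold l2
  calc ∫ U, ψ U * φ U ∂configMeasure SU2 L = ∫ U, gaugeAvg (sliceFn χ ψ) U * φ U ∂configMeasure SU2 L := by
        refine integral_congr_ae (ae_of_all _ fun U => ?_)
        dsimp only
        rw [gaugeAvg_sliceFn hψinv hψcov]
    _ = ∫ U, sliceFn χ ψ U * φ U ∂configMeasure SU2 L :=
        integral_gaugeAvg_mul_invariant (measurable_sliceFn hχ hψ) (abs_sliceFn_le hCχ hCψ hn₀ hN) hφ hCφ hφinv

/-- ★ **`L²` pairing through the slice, weighted form** for an IDEMPOTENT weight (`χ² = χ`: indicators of tubes):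
`⟨ψ, φ⟩ = ∫ (sliceFn χ ψ)(U) (sliceFn χ φ)(U) · N(U) dU` with `N = gaugeAvg χ` — the invariant `L²` problem is the `L²(N dU)` problem of the
slice functions. [cite: SeilerLNP1982, §2] -/
theorem l2_eq_integral_sliceFn_mul_weight {χ ψ φ : GaugeConfig 3 L SU2 → ℝ} (hχ : Measurable χ) {Cχ : ℝ} (hCχ : ∀ U, |χ U| ≤ Cχ)
    (hχidem : ∀ U, χ U * χ U = χ U) {n₀ : ℝ} (hn₀ : 0 < n₀) (hN : ∀ U, χ U ≠ 0 → n₀ ≤ gaugeAvg χ U)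
    (hψ : Measurable ψ) {Cψ : ℝ} (hCψ : ∀ U, |ψ U| ≤ Cψ) (hψinv : ∀ (g : Site 3 L → SU2) (U : GaugeConfig 3 L SU2), ψ (gaugeTransform g U) = ψ U)
    (hψcov : ∀ U, ψ U ≠ 0 → gaugeAvg χ U ≠ 0)
    (hφ : Measurable φ) {Cφ : ℝ} (hCφ : ∀ U, |φ U| ≤ Cφ) (hφinv : ∀ (g : Site 3 L → SU2) (U : GaugeConfig 3 L SU2), φ (gaugeTransform g U) = φ U) :
    l2 ψ φ = ∫ U, sliceFn χ ψ U * sliceFn χ φ U * gaugeAvg χ U ∂configMeasure SU2 L := by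
  rw [l2_eq_sliceFn_left hχ hCχ hn₀ hN hψ hCψ hψinv hψcov hφ hCφ hφinv]
  unfold l2
  refine integral_congr_ae (ae_of_all _ fun U => ?_)
  dsimp only
  unfold sliceFn
  by_cases h0 : χ U = 0
  · simp [h0]
  · have hN0 : gaugeAvg χ U ≠ 0 := (hn₀.trans_le (hN U h0)).ne'
    calc ψ U * χ U / gaugeAvg χ U * φ U = ψ U * (χ U * χ U) / gaugeAvg χ U * φ U := by rw [hχidem]
      _ = ψ U * χ U / gaugeAvg χ U * (φ U * χ U / gaugeAvg χ U) * gaugeAvg χ U := by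
          symm; rw [mul_assoc, div_mul_cancel₀ _ hN0]; ring

end Summit.QuantumFields.YangMills.Theorems.FemtoTransferGap.TwoLattice.Avg

end
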